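import Summits.AtomisticToContinuum.HydrodynamicLimit.Theorems.CollisionIsometryCLTAdaptedWeightCLTBHDVTransferCellLaw
import Summits.AtomisticToContinuum.HydrodynamicLimit.Theorems.CollisionIsometryCLTAdaptedWeightCLTBHDVTransferContact

/-!
# DV transfer for the line `block-h-dissipation-closure` (crux `AdaptedWeightCLT`, stmt-AtomisticToContinuum-14868),
# file 9: quadratic moments of Gaussian mixtures on `Quad`; integrability of `ΔΛ · contactDens` and of
# `contactDens · log contactDens`

Support file (`--supports stmt-AtomisticToContinuum-14868`, anchor `bhDVTransfer_moments_anchor`) of the line lead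
`prover-line-stmt-AtomisticToContinuum-14868-c4-0`, written for the registered stub `stub_dvTransfer` (S2): discharge
of two of the four integrability side conditions of the Donsker–Varadhan step `DVTransfer.dv_step` (file 5) on every
good orbit, from the quadratic log-envelope of the regularised cell law (file 8).

* one velocity: `t e^{-t/(4h²)} ≤ 4h²`, hence `‖v − u‖² G_h(v − a) ≤ C e^{-‖v−a‖²/(4h²)}` and
  `integrable_normSq_mul_gauss` (second moments of a Gaussian about any centre, by domination with the Gaussian of
  width `√2 h`; no appeal to Mathlib's Gaussian measures);
* four velocities: `integrable_quad_prod` (products over `Quad = V3 × (V3 × (V3 × V3))`),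
  `integrable_quadMoment_mul_gauss4` (`(A + B Σ_m ‖y_m − c_m‖²) G_h^{⊗4}(y − c′)` is integrable) and its
  finite-mixture form `integrable_quadMoment_mul_contactDens`;
* `integrable_dLam_mul_contactDens` — side condition (i3) of `dv_step`: `(ΔΛ/2) · contactDens` is integrable
  (`|Λ(v)| ≤ L + ‖v − ū‖²/(2h²)`, `abs_log_cellLaw_le`);
* `integrable_contactDens_mul_log` — side condition (i1): `contactDens · log contactDens` is integrable (upper bound
  `contactDens ≤ contactMass · G_h(0)⁴`, lower bound by ONE charged component `cw_a G_h^{⊗4}(· − quad)`, whose log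
  is quadratic; the empty window `contactMass = 0` has `contactDens ≡ 0`).

No definitions.
-/

namespace Summit.AtomisticToContinuum.HydrodynamicLimit.Theorems.BlockHDissipation

open scoped BigOperators Topology Classical MeasureTheory ENNReal InnerProductSpace
open Filter Set MeasureTheory Real
open Literature.Analysis.FluidPDE
open Summit.AtomisticToContinuum.HydrodynamicLimit.Theorems.ContactSourceDuhamel (T3 V3 Cfg Vel Flow Flows)
open Literature.MathematicalPhysics.KineticTheory (hsDiameter collide hardSphereKernel sphereMeasure)

noncomputable section

namespace DVTransfer

/-! ## One velocity -/

/-- `t e^{-t/c} ≤ c` for `c > 0` (from `1 + s ≤ e^s`). -/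
theorem mul_exp_neg_div_le (t : ℝ) {c : ℝ} (hc : 0 < c) : t * Real.exp (-(t / c)) ≤ c := by
  have h1 : t / c ≤ Real.exp (t / c) := by
    have := Real.add_one_le_exp (t / c); linarith
  rw [Real.exp_neg]
  have hpos : 0 < Real.exp (t / c) := Real.exp_pos _
  rw [mul_inv_le_iff₀ hpos]
  calc t = c * (t / c) := by field_simp
    _ ≤ c * Real.exp (t / c) := mul_le_mul_of_nonneg_left h1 hc.le

/-- The mollifier in closed form: `G_h(v − a) = (2πh²)^{-3/2} e^{-‖v − a‖²/(2h²)}`. -/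
theorem gauss_eq_prefactor_mul_exp (h : ℝ) (a v : V3) :
    gauss h a v = (2 * π * h ^ 2) ^ (-(Module.finrank ℝ V3 : ℝ) / 2) * Real.exp (-‖v - a‖ ^ 2 / (2 * h ^ 2)) := by
  simp [gauss, localMaxwellian]

/-- **Domination of the second moment density**: `‖v − u‖² G_h(v − a) ≤ (8h² + 2‖a − u‖²) (2πh²)^{-3/2} e^{-‖v−a‖²/(4h²)}`
(`h ≠ 0`). -/
theorem normSq_mul_gauss_le {h : ℝ} (hh : h ≠ 0) (a u v : V3) :
    ‖v - u‖ ^ 2 * gauss h a v ≤ (8 * h ^ 2 + 2 * ‖a - u‖ ^ 2) *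
      ((2 * π * h ^ 2) ^ (-(Module.finrank ℝ V3 : ℝ) / 2) * Real.exp (-(‖v - a‖ ^ 2 / (4 * h ^ 2)))) := by
  have hh2 : 0 < h ^ 2 := pow_pos (abs_pos.2 hh) 2 |>.trans_eq (sq_abs h)
  have hpref : 0 < (2 * π * h ^ 2) ^ (-(Module.finrank ℝ V3 : ℝ) / 2) := by positivity
  -- `‖v − u‖² ≤ 2‖v − a‖² + 2‖a − u‖²`
  have htri : ‖v - u‖ ^ 2 ≤ 2 * ‖v - a‖ ^ 2 + 2 * ‖a - u‖ ^ 2 := by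
    have h1 : ‖v - u‖ ≤ ‖v - a‖ + ‖a - u‖ := by
      have : v - u = (v - a) + (a - u) := by abel
      rw [this]; exact norm_add_le _ _
    nlinarith [norm_nonneg (v - u), norm_nonneg (v - a), norm_nonneg (a - u), sq_nonneg (‖v - a‖ - ‖a - u‖)]
  -- split the Gaussian: `e^{-s/(2h²)} = e^{-s/(4h²)} e^{-s/(4h²)}`
  set s : ℝ := ‖v - a‖ ^ 2 with hs
  have hs0 : 0 ≤ s := sq_nonneg _
  have hsplit : Real.exp (-s / (2 * h ^ 2)) = Real.exp (-(s / (4 * h ^ 2))) * Real.exp (-(s / (4 * h ^ 2))) := by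
    rw [← Real.exp_add]; congr 1; field_simp; ring
  have hkey : s * Real.exp (-(s / (4 * h ^ 2))) ≤ 4 * h ^ 2 := mul_exp_neg_div_le s (by positivity)
  have hE : 0 < Real.exp (-(s / (4 * h ^ 2))) := Real.exp_pos _
  have hE1 : Real.exp (-(s / (4 * h ^ 2))) ≤ 1 := Real.exp_le_one_iff.2 (by
    have : 0 ≤ s / (4 * h ^ 2) := by positivity
    linarith)
  rw [gauss_eq_prefactor_mul_exp, ← hs, hsplit]
  -- goal: ‖v-u‖² * (P * (E * E)) ≤ (8h² + 2‖a-u‖²) * (P * E)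
  have h3 : ‖v - u‖ ^ 2 * Real.exp (-(s / (4 * h ^ 2))) ≤ 8 * h ^ 2 + 2 * ‖a - u‖ ^ 2 := by
    calc ‖v - u‖ ^ 2 * Real.exp (-(s / (4 * h ^ 2)))
        ≤ (2 * s + 2 * ‖a - u‖ ^ 2) * Real.exp (-(s / (4 * h ^ 2))) :=
          mul_le_mul_of_nonneg_right htri hE.le
      _ = 2 * (s * Real.exp (-(s / (4 * h ^ 2)))) + 2 * ‖a - u‖ ^ 2 * Real.exp (-(s / (4 * h ^ 2))) := by ring
      _ ≤ 2 * (4 * h ^ 2) + 2 * ‖a - u‖ ^ 2 * 1 := by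
          gcongr
      _ = 8 * h ^ 2 + 2 * ‖a - u‖ ^ 2 := by ring
  calc ‖v - u‖ ^ 2 * ((2 * π * h ^ 2) ^ (-(Module.finrank ℝ V3 : ℝ) / 2) *
        (Real.exp (-(s / (4 * h ^ 2))) * Real.exp (-(s / (4 * h ^ 2)))))
      = (‖v - u‖ ^ 2 * Real.exp (-(s / (4 * h ^ 2)))) *
          ((2 * π * h ^ 2) ^ (-(Module.finrank ℝ V3 : ℝ) / 2) * Real.exp (-(s / (4 * h ^ 2)))) := by ring
    _ ≤ (8 * h ^ 2 + 2 * ‖a - u‖ ^ 2) *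
          ((2 * π * h ^ 2) ^ (-(Module.finrank ℝ V3 : ℝ) / 2) * Real.exp (-(s / (4 * h ^ 2)))) :=
        mul_le_mul_of_nonneg_right h3 (mul_nonneg hpref.le hE.le)

/-- The Gaussian of width `√2 h` about `a` in exponential form is integrable:
`v ↦ e^{-‖v − a‖²/(4h²)}` (a positive multiple of `M_{1, 2h², a}`; `h ≠ 0`). -/
theorem integrable_exp_neg_normSq_div_four {h : ℝ} (hh : h ≠ 0) (a : V3) :
    Integrable fun v : V3 => Real.exp (-(‖v - a‖ ^ 2 / (4 * h ^ 2))) := by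
  have hh2 : 0 < h ^ 2 := pow_pos (abs_pos.2 hh) 2 |>.trans_eq (sq_abs h)
  have hθ : 0 < 2 * h ^ 2 := by positivity
  have hpref : 0 < (2 * π * (2 * h ^ 2)) ^ (-(Module.finrank ℝ V3 : ℝ) / 2) := by positivity
  have hM := (Literature.MathematicalPhysics.KineticTheory.integrable_localMaxwellian hθ a).const_mul
    ((2 * π * (2 * h ^ 2)) ^ (-(Module.finrank ℝ V3 : ℝ) / 2))⁻¹
  refine hM.congr (Eventually.of_forall fun v => ?_)
  simp only [localMaxwellian, one_mul]
  rw [← mul_assoc, inv_mul_cancel₀ hpref.ne', one_mul]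
  congr 1
  field_simp
  ring

/-- **Second moments of the mollifier about any centre**: `v ↦ ‖v − u‖² G_h(v − a)` is integrable (`h ≠ 0`). -/
theorem integrable_normSq_mul_gauss {h : ℝ} (hh : h ≠ 0) (a u : V3) :
    Integrable fun v : V3 => ‖v - u‖ ^ 2 * gauss h a v := by
  have hdom := (integrable_exp_neg_normSq_div_four hh a).const_mul
    ((8 * h ^ 2 + 2 * ‖a - u‖ ^ 2) * (2 * π * h ^ 2) ^ (-(Module.finrank ℝ V3 : ℝ) / 2))
  refine hdom.mono' ?_ (Eventually.of_forall fun v => ?_)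
  · exact ((continuous_norm.comp (continuous_id.sub continuous_const)).pow 2).aestronglyMeasurable.mul
      (continuous_gauss h a).aestronglyMeasurable
  · rw [Real.norm_eq_abs, abs_of_nonneg (mul_nonneg (sq_nonneg _) (gauss_nonneg h a v)), mul_assoc]
    exact normSq_mul_gauss_le hh a u v

/-! ## Four velocities -/

/-- Products over `Quad = V3 × (V3 × (V3 × V3))` of integrable functions of one velocity are integrable. -/
theorem integrable_quad_prod {F₁ F₂ F₃ F₄ : V3 → ℝ} (h₁ : Integrable F₁) (h₂ : Integrable F₂) (h₃ : Integrable F₃)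
    (h₄ : Integrable F₄) : Integrable fun y : Quad => F₁ y.1 * (F₂ y.2.1 * (F₃ y.2.2.1 * F₄ y.2.2.2)) := by
  have i4 : Integrable (fun y : V3 × V3 => F₃ y.1 * F₄ y.2) ((volume : Measure V3).prod volume) := h₃.mul_prod h₄
  have i3 : Integrable (fun y : V3 × V3 × V3 => F₂ y.1 * (F₃ y.2.1 * F₄ y.2.2))
      ((volume : Measure V3).prod ((volume : Measure V3).prod volume)) := h₂.mul_prod i4
  exact h₁.mul_prod i3

/-- The quadratic moment weight of `Quad` about the centres `c`: `Σ_m ‖y_m − c_m‖²`, times `G_h^{⊗4}(y − c′)`, is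
integrable, together with any affine combination `A + B Σ_m ‖y_m − c_m‖²` (`h ≠ 0`). -/
theorem integrable_quadMoment_mul_gauss4 {h : ℝ} (hh : h ≠ 0) (A B : ℝ) (c c' : Quad) :
    Integrable fun y : Quad => (A + B * (‖y.1 - c.1‖ ^ 2 + ‖y.2.1 - c.2.1‖ ^ 2 + ‖y.2.2.1 - c.2.2.1‖ ^ 2 +
      ‖y.2.2.2 - c.2.2.2‖ ^ 2)) * gauss4 h c' y := by
  have g1 := integrable_gauss hh c'.1
  have g2 := integrable_gauss hh c'.2.1
  have g3 := integrable_gauss hh c'.2.2.1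
  have g4 := integrable_gauss hh c'.2.2.2
  have m1 := integrable_normSq_mul_gauss hh c'.1 c.1
  have m2 := integrable_normSq_mul_gauss hh c'.2.1 c.2.1
  have m3 := integrable_normSq_mul_gauss hh c'.2.2.1 c.2.2.1
  have m4 := integrable_normSq_mul_gauss hh c'.2.2.2 c.2.2.2
  have T0 := integrable_gauss4 hh c'
  have T1 := integrable_quad_prod m1 g2 g3 g4
  have T2 := integrable_quad_prod g1 m2 g3 g4
  have T3 := integrable_quad_prod g1 g2 m3 g4
  have T4 := integrable_quad_prod g1 g2 g3 m4
  have hsum := (T0.const_mul A).add ((((T1.add T2).add T3).add T4).const_mul B)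
  refine hsum.congr (Eventually.of_forall fun y => ?_)
  simp only [gauss4, Pi.add_apply]
  ring

/-- Finite-mixture form: `(A + B Σ_m ‖y_m − c_m‖²) · contactDens` is integrable on `Quad` (`h ≠ 0`; finitely many
collisions in the window). -/
theorem integrable_quadMoment_mul_contactDens {σ : ℝ} {N : ℕ} (Φ : Flow σ N) (ψ : ℕ → T3 → ℝ) (γc : ℝ) {h : ℝ}
    (hh : h ≠ 0) (t : ℝ) (z : Cfg N) (k : ℕ) (x : T3)
    (hfin : (collisionTimes (Torus.geometry (Fin 3)) (hsDiameter σ N) (fun s => Φ.flow s z) ∩ win γc N t k).Finite)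
    (A B : ℝ) (c : Quad) :
    Integrable fun y : Quad => (A + B * (‖y.1 - c.1‖ ^ 2 + ‖y.2.1 - c.2.1‖ ^ 2 + ‖y.2.2.1 - c.2.2.1‖ ^ 2 +
      ‖y.2.2.2 - c.2.2.2‖ ^ 2)) * contactDens σ N Φ ψ γc h t z k x y := by
  have e : (fun y : Quad => (A + B * (‖y.1 - c.1‖ ^ 2 + ‖y.2.1 - c.2.1‖ ^ 2 + ‖y.2.2.1 - c.2.2.1‖ ^ 2 +
      ‖y.2.2.2 - c.2.2.2‖ ^ 2)) * contactDens σ N Φ ψ γc h t z k x y) = fun y => ∑ s ∈ hfin.toFinset,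
      ∑ p ∈ contactPairs (Torus.geometry (Fin 3)) (hsDiameter σ N) (Φ.flow s z),
        cw N ψ (Φ.flow s z) x p.1 * ((A + B * (‖y.1 - c.1‖ ^ 2 + ‖y.2.1 - c.2.1‖ ^ 2 + ‖y.2.2.1 - c.2.2.1‖ ^ 2 +
          ‖y.2.2.2 - c.2.2.2‖ ^ 2)) * gauss4 h (quadOf N (Φ.flow s z) p.1 p.2) y) := by
    funext y
    rw [contactDens_eq_sum Φ ψ γc h t z k x hfin y, Finset.mul_sum]
    refine Finset.sum_congr rfl fun s _ => ?_
    rw [Finset.mul_sum]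
    refine Finset.sum_congr rfl fun p _ => ?_
    ring
  rw [e]
  refine integrable_finsetSum _ fun s _ => integrable_finsetSum _ fun p _ => ?_
  exact (integrable_quadMoment_mul_gauss4 hh A B c _).const_mul _

/-! ## Side condition (i3): `ΔΛ · contactDens` -/

/-- **(i3)** For a nonnegative kernel family, `h ≠ 0`, `0 < δ ≤ 1` and a good initial datum, the DV test function
`½ ΔΛ` (log-increment of the window-start regularised cell law) is integrable against the smeared contact density of
any window `k` at any `x`. -/
theorem integrable_dLam_mul_contactDens {ψ : ℕ → T3 → ℝ} (hψ : ∀ N y, 0 ≤ ψ N y) {h : ℝ} (hh : h ≠ 0) {δ : ℝ}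
    (hδ0 : 0 < δ) (hδ1 : δ ≤ 1) {σ : ℝ} {N : ℕ} (Φ : Flow σ N) (γc t : ℝ) {z : Cfg N} (hz : z ∈ Φ.good) (k : ℕ)
    (x : T3) (w : Cfg N) :
    Integrable fun y : Quad =>
      2⁻¹ * (Real.log (cellLaw N ψ h δ w x y.2.2.1) + Real.log (cellLaw N ψ h δ w x y.2.2.2) -
        Real.log (cellLaw N ψ h δ w x y.1) - Real.log (cellLaw N ψ h δ w x y.2.1)) *
        contactDens σ N Φ ψ γc h t z k x y := by
  have hfin := finite_collisionTimes_win Φ hz γc t k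
  set L : ℝ := |Real.log (gauss h (0 : V3) 0)| + |Real.log δ| +
    |Real.log ((2 * π * (cT N ψ w x + h ^ 2)) ^ (-(Module.finrank ℝ V3 : ℝ) / 2))| with hL
  set u : V3 := cU N ψ w x with hu
  have hΛ : ∀ v, |Real.log (cellLaw N ψ h δ w x v)| ≤ L + ‖v - u‖ ^ 2 / (2 * h ^ 2) :=
    fun v => abs_log_cellLaw_le hψ hh hδ0 hδ1 w x v
  have hdom := integrable_quadMoment_mul_contactDens Φ ψ γc hh t z k x hfin (2⁻¹ * (4 * L)) (2⁻¹ * (2 * h ^ 2)⁻¹)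
    ((u, u, u, u) : Quad)
  have hmeas : AEStronglyMeasurable (fun y : Quad =>
      2⁻¹ * (Real.log (cellLaw N ψ h δ w x y.2.2.1) + Real.log (cellLaw N ψ h δ w x y.2.2.2) -
        Real.log (cellLaw N ψ h δ w x y.1) - Real.log (cellLaw N ψ h δ w x y.2.1)) *
        contactDens σ N Φ ψ γc h t z k x y) volume := by
    have hl := measurable_log_cellLaw ψ h δ w x
    refine (Measurable.aestronglyMeasurable ?_).mul (continuous_contactDens Φ ψ γc h t z k x hfin).aestronglyMeasurable
    exact measurable_const.mul ((((hl.comp measurable_snd.snd.fst).add (hl.comp measurable_snd.snd.snd)).sub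
      (hl.comp measurable_fst)).sub (hl.comp measurable_snd.fst))
  refine hdom.mono' hmeas (Eventually.of_forall fun y => ?_)
  have hp : 0 ≤ contactDens σ N Φ ψ γc h t z k x y := contactDens_nonneg hψ Φ γc hh t z k x hfin y
  rw [Real.norm_eq_abs, abs_mul, abs_of_nonneg hp]
  refine mul_le_mul_of_nonneg_right ?_ hp
  rw [abs_mul, abs_of_pos (by norm_num : (0 : ℝ) < 2⁻¹)]
  have h1 := hΛ y.2.2.1
  have h2 := hΛ y.2.2.2
  have h3 := hΛ y.1
  have h4 := hΛ y.2.1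
  have habs : |Real.log (cellLaw N ψ h δ w x y.2.2.1) + Real.log (cellLaw N ψ h δ w x y.2.2.2) -
      Real.log (cellLaw N ψ h δ w x y.1) - Real.log (cellLaw N ψ h δ w x y.2.1)| ≤
      4 * L + (2 * h ^ 2)⁻¹ * (‖y.1 - u‖ ^ 2 + ‖y.2.1 - u‖ ^ 2 + ‖y.2.2.1 - u‖ ^ 2 + ‖y.2.2.2 - u‖ ^ 2) := by
    have e : ∀ s : ℝ, s / (2 * h ^ 2) = (2 * h ^ 2)⁻¹ * s := fun s => by rw [div_eq_inv_mul]
    rw [e] at h1 h2 h3 h4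
    have t1 := abs_sub (Real.log (cellLaw N ψ h δ w x y.2.2.1) + Real.log (cellLaw N ψ h δ w x y.2.2.2) -
      Real.log (cellLaw N ψ h δ w x y.1)) (Real.log (cellLaw N ψ h δ w x y.2.1))
    have t2 := abs_sub (Real.log (cellLaw N ψ h δ w x y.2.2.1) + Real.log (cellLaw N ψ h δ w x y.2.2.2))
      (Real.log (cellLaw N ψ h δ w x y.1))
    have t3 := abs_add_le (Real.log (cellLaw N ψ h δ w x y.2.2.1)) (Real.log (cellLaw N ψ h δ w x y.2.2.2))
    linarith
  calc 2⁻¹ * |Real.log (cellLaw N ψ h δ w x y.2.2.1) + Real.log (cellLaw N ψ h δ w x y.2.2.2) -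
        Real.log (cellLaw N ψ h δ w x y.1) - Real.log (cellLaw N ψ h δ w x y.2.1)|
      ≤ 2⁻¹ * (4 * L + (2 * h ^ 2)⁻¹ * (‖y.1 - u‖ ^ 2 + ‖y.2.1 - u‖ ^ 2 + ‖y.2.2.1 - u‖ ^ 2 + ‖y.2.2.2 - u‖ ^ 2)) :=
        mul_le_mul_of_nonneg_left habs (by norm_num)
    _ = 2⁻¹ * (4 * L) + 2⁻¹ * (2 * h ^ 2)⁻¹ *
          (‖y.1 - u‖ ^ 2 + ‖y.2.1 - u‖ ^ 2 + ‖y.2.2.1 - u‖ ^ 2 + ‖y.2.2.2 - u‖ ^ 2) := by ring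

/-! ## Side condition (i1): `contactDens · log contactDens` -/

/-- `log G_h(v − a) = log (2πh²)^{-3/2} − ‖v − a‖²/(2h²)` (`h ≠ 0`). -/
theorem log_gauss {h : ℝ} (hh : h ≠ 0) (a v : V3) :
    Real.log (gauss h a v) = Real.log ((2 * π * h ^ 2) ^ (-(Module.finrank ℝ V3 : ℝ) / 2)) - ‖v - a‖ ^ 2 / (2 * h ^ 2) := by
  have hh2 : 0 < h ^ 2 := pow_pos (abs_pos.2 hh) 2 |>.trans_eq (sq_abs h)
  have hpref : 0 < (2 * π * h ^ 2) ^ (-(Module.finrank ℝ V3 : ℝ) / 2) := by positivity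
  rw [gauss_eq_prefactor_mul_exp, Real.log_mul hpref.ne' (Real.exp_pos _).ne', Real.log_exp]
  ring

/-- The log of `G_h^{⊗4}` is quadratic: `|log G_h^{⊗4}(y − c)| ≤ 4 |log (2πh²)^{-3/2}| + Σ_m ‖y_m − c_m‖²/(2h²)`. -/
theorem abs_log_gauss4_le {h : ℝ} (hh : h ≠ 0) (c y : Quad) :
    |Real.log (gauss4 h c y)| ≤ 4 * |Real.log ((2 * π * h ^ 2) ^ (-(Module.finrank ℝ V3 : ℝ) / 2))| +
      (2 * h ^ 2)⁻¹ * (‖y.1 - c.1‖ ^ 2 + ‖y.2.1 - c.2.1‖ ^ 2 + ‖y.2.2.1 - c.2.2.1‖ ^ 2 + ‖y.2.2.2 - c.2.2.2‖ ^ 2) := by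
  have hh2 : 0 < h ^ 2 := pow_pos (abs_pos.2 hh) 2 |>.trans_eq (sq_abs h)
  have g1 := gauss_pos hh c.1 y.1
  have g2 := gauss_pos hh c.2.1 y.2.1
  have g3 := gauss_pos hh c.2.2.1 y.2.2.1
  have g4 := gauss_pos hh c.2.2.2 y.2.2.2
  have e : Real.log (gauss4 h c y) = Real.log (gauss h c.1 y.1) + Real.log (gauss h c.2.1 y.2.1) +
      Real.log (gauss h c.2.2.1 y.2.2.1) + Real.log (gauss h c.2.2.2 y.2.2.2) := by
    unfold gauss4
    rw [Real.log_mul (mul_pos (mul_pos g1 g2) g3).ne' g4.ne', Real.log_mul (mul_pos g1 g2).ne' g3.ne',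
      Real.log_mul g1.ne' g2.ne']
  rw [e, log_gauss hh, log_gauss hh, log_gauss hh, log_gauss hh]
  set P := Real.log ((2 * π * h ^ 2) ^ (-(Module.finrank ℝ V3 : ℝ) / 2))
  have q1 : 0 ≤ ‖y.1 - c.1‖ ^ 2 / (2 * h ^ 2) := by positivity
  have q2 : 0 ≤ ‖y.2.1 - c.2.1‖ ^ 2 / (2 * h ^ 2) := by positivity
  have q3 : 0 ≤ ‖y.2.2.1 - c.2.2.1‖ ^ 2 / (2 * h ^ 2) := by positivity
  have q4 : 0 ≤ ‖y.2.2.2 - c.2.2.2‖ ^ 2 / (2 * h ^ 2) := by positivity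
  have ed : (2 * h ^ 2)⁻¹ * (‖y.1 - c.1‖ ^ 2 + ‖y.2.1 - c.2.1‖ ^ 2 + ‖y.2.2.1 - c.2.2.1‖ ^ 2 + ‖y.2.2.2 - c.2.2.2‖ ^ 2) =
      ‖y.1 - c.1‖ ^ 2 / (2 * h ^ 2) + ‖y.2.1 - c.2.1‖ ^ 2 / (2 * h ^ 2) + ‖y.2.2.1 - c.2.2.1‖ ^ 2 / (2 * h ^ 2) +
        ‖y.2.2.2 - c.2.2.2‖ ^ 2 / (2 * h ^ 2) := by
    field_simp
  rw [ed, abs_le]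
  constructor
  · have := neg_abs_le P; linarith
  · have := le_abs_self P; linarith

/-- `G_h^{⊗4} ≤ G_h(0)⁴`. -/
theorem gauss4_le_gaussMax_pow (h : ℝ) (c y : Quad) : gauss4 h c y ≤ gauss h (0 : V3) 0 ^ 4 := by
  unfold gauss4
  have b1 := gauss_le_gaussMax h c.1 y.1
  have b2 := gauss_le_gaussMax h c.2.1 y.2.1
  have b3 := gauss_le_gaussMax h c.2.2.1 y.2.2.1
  have b4 := gauss_le_gaussMax h c.2.2.2 y.2.2.2
  have n1 := gauss_nonneg h c.1 y.1
  have n2 := gauss_nonneg h c.2.1 y.2.1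
  have n3 := gauss_nonneg h c.2.2.1 y.2.2.1
  have n4 := gauss_nonneg h c.2.2.2 y.2.2.2
  have n0 := gauss_nonneg h (0 : V3) 0
  calc gauss h c.1 y.1 * gauss h c.2.1 y.2.1 * gauss h c.2.2.1 y.2.2.1 * gauss h c.2.2.2 y.2.2.2
      ≤ gauss h 0 0 * gauss h 0 0 * gauss h 0 0 * gauss h 0 0 :=
        mul_le_mul (mul_le_mul (mul_le_mul b1 b2 n2 n0) b3 n3 (mul_nonneg n0 n0)) b4 n4
          (mul_nonneg (mul_nonneg n0 n0) n0)
    _ = gauss h 0 0 ^ 4 := by ring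

/-- The smeared contact density is bounded by its mass times the peak: `contactDens ≤ contactMass · G_h(0)⁴`
(nonnegative kernel family; finitely many collisions in the window). -/
theorem contactDens_le {σ : ℝ} {N : ℕ} {ψ : ℕ → T3 → ℝ} (hψ : ∀ N y, 0 ≤ ψ N y) (Φ : Flow σ N) (γc h t : ℝ)
    (z : Cfg N) (k : ℕ) (x : T3)
    (hfin : (collisionTimes (Torus.geometry (Fin 3)) (hsDiameter σ N) (fun s => Φ.flow s z) ∩ win γc N t k).Finite)
    (y : Quad) : contactDens σ N Φ ψ γc h t z k x y ≤ contactMass σ N Φ ψ γc t z k x * gauss h (0 : V3) 0 ^ 4 := by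
  rw [contactDens_eq_sum Φ ψ γc h t z k x hfin, contactMass_eq_sum Φ ψ γc t z k x hfin, Finset.sum_mul]
  refine Finset.sum_le_sum fun s _ => ?_
  rw [Finset.sum_mul]
  refine Finset.sum_le_sum fun p _ => ?_
  exact mul_le_mul_of_nonneg_left (gauss4_le_gaussMax_pow h _ y) (cw_nonneg hψ N _ x _)

/-- For `0 < a ≤ p ≤ b`: `|log p| ≤ |log a| + |log b|`. -/
theorem abs_log_le_of_mem {a p b : ℝ} (ha : 0 < a) (hap : a ≤ p) (hpb : p ≤ b) :
    |Real.log p| ≤ |Real.log a| + |Real.log b| := by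
  have hp : 0 < p := lt_of_lt_of_le ha hap
  have h1 : Real.log a ≤ Real.log p := Real.log_le_log ha hap
  have h2 : Real.log p ≤ Real.log b := Real.log_le_log hp hpb
  rw [abs_le]
  constructor
  · have := neg_abs_le (Real.log a); have := abs_nonneg (Real.log b); linarith
  · have := le_abs_self (Real.log b); have := abs_nonneg (Real.log a); linarith

/-- **(i1)** For a nonnegative kernel family, `h ≠ 0` and a good initial datum, `contactDens · log contactDens` is
integrable on `Quad` for every window `k` and location `x`. -/
theorem integrable_contactDens_mul_log {ψ : ℕ → T3 → ℝ} (hψ : ∀ N y, 0 ≤ ψ N y) {h : ℝ} (hh : h ≠ 0) {σ : ℝ}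
    {N : ℕ} (Φ : Flow σ N) (γc t : ℝ) {z : Cfg N} (hz : z ∈ Φ.good) (k : ℕ) (x : T3) :
    Integrable fun y : Quad =>
      contactDens σ N Φ ψ γc h t z k x y * Real.log (contactDens σ N Φ ψ γc h t z k x y) := by
  have hfin := finite_collisionTimes_win Φ hz γc t k
  have hcont := continuous_contactDens Φ ψ γc h t z k x hfin
  have hmeas : AEStronglyMeasurable (fun y : Quad =>
      contactDens σ N Φ ψ γc h t z k x y * Real.log (contactDens σ N Φ ψ γc h t z k x y)) volume :=
    hcont.aestronglyMeasurable.mul (Real.measurable_log.comp hcont.measurable).aestronglyMeasurable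
  by_cases hn : contactMass σ N Φ ψ γc t z k x = 0
  · -- empty window: `contactDens ≡ 0`
    refine (integrable_zero Quad ℝ volume).congr (Eventually.of_forall fun y => ?_)
    simp only [contactDens_eq_zero_of_contactMass_eq_zero hψ Φ γc h t z k x hfin hn y, zero_mul, Pi.zero_apply]
  · -- a charged component `(s₀, p₀)` with positive weight
    have hnpos : 0 < contactMass σ N Φ ψ γc t z k x := lt_of_le_of_ne (contactMass_nonneg hψ Φ γc t z k x hfin) (Ne.symm hn)
    have hsum := contactMass_eq_sum Φ ψ γc t z k x hfin
    obtain ⟨s₀, hs₀, hs₀pos⟩ : ∃ s₀ ∈ hfin.toFinset, 0 < ∑ p ∈ contactPairs (Torus.geometry (Fin 3)) (hsDiameter σ N)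
        (Φ.flow s₀ z), cw N ψ (Φ.flow s₀ z) x p.1 := by
      by_contra hcon
      push Not at hcon
      have : contactMass σ N Φ ψ γc t z k x ≤ 0 := by rw [hsum]; exact Finset.sum_nonpos hcon
      exact absurd hnpos (not_lt.2 this)
    obtain ⟨p₀, hp₀, hp₀pos⟩ : ∃ p₀ ∈ contactPairs (Torus.geometry (Fin 3)) (hsDiameter σ N) (Φ.flow s₀ z),
        0 < cw N ψ (Φ.flow s₀ z) x p₀.1 := by
      by_contra hcon
      push Not at hcon
      exact absurd hs₀pos (not_lt.2 (Finset.sum_nonpos hcon))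
    set a₀ : ℝ := cw N ψ (Φ.flow s₀ z) x p₀.1 with ha₀
    set q₀ : Quad := quadOf N (Φ.flow s₀ z) p₀.1 p₀.2 with hq₀
    -- lower bound `a₀ G^{⊗4}(· − q₀) ≤ contactDens`
    have hlow : ∀ y, a₀ * gauss4 h q₀ y ≤ contactDens σ N Φ ψ γc h t z k x y := by
      intro y
      rw [contactDens_eq_sum Φ ψ γc h t z k x hfin]
      refine le_trans ?_ (Finset.single_le_sum (f := fun s => ∑ p ∈ contactPairs (Torus.geometry (Fin 3))
        (hsDiameter σ N) (Φ.flow s z), cw N ψ (Φ.flow s z) x p.1 * gauss4 h (quadOf N (Φ.flow s z) p.1 p.2) y)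
        (fun s _ => Finset.sum_nonneg fun p _ => mul_nonneg (cw_nonneg hψ N _ x _) (gauss4_pos hh _ _).le) hs₀)
      exact Finset.single_le_sum (f := fun p => cw N ψ (Φ.flow s₀ z) x p.1 * gauss4 h (quadOf N (Φ.flow s₀ z) p.1 p.2) y)
        (fun p _ => mul_nonneg (cw_nonneg hψ N _ x _) (gauss4_pos hh _ _).le) hp₀
    -- the quadratic envelope of `log contactDens`
    set P : ℝ := Real.log ((2 * π * h ^ 2) ^ (-(Module.finrank ℝ V3 : ℝ) / 2)) with hP
    set L₁ : ℝ := |Real.log a₀| + 4 * |P| + |Real.log (contactMass σ N Φ ψ γc t z k x * gauss h (0 : V3) 0 ^ 4)|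
      with hL₁
    have hdom := integrable_quadMoment_mul_contactDens Φ ψ γc hh t z k x hfin L₁ (2 * h ^ 2)⁻¹ q₀
    refine hdom.mono' hmeas (Eventually.of_forall fun y => ?_)
    have hp : 0 ≤ contactDens σ N Φ ψ γc h t z k x y := contactDens_nonneg hψ Φ γc hh t z k x hfin y
    rw [Real.norm_eq_abs, abs_mul, abs_of_nonneg hp, mul_comm]
    refine mul_le_mul_of_nonneg_right ?_ hp
    have hapos : 0 < a₀ * gauss4 h q₀ y := mul_pos hp₀pos (gauss4_pos hh _ _)
    have hb := abs_log_le_of_mem hapos (hlow y) (contactDens_le hψ Φ γc h t z k x hfin y)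
    have hloga : |Real.log (a₀ * gauss4 h q₀ y)| ≤ |Real.log a₀| + (4 * |P| +
        (2 * h ^ 2)⁻¹ * (‖y.1 - q₀.1‖ ^ 2 + ‖y.2.1 - q₀.2.1‖ ^ 2 + ‖y.2.2.1 - q₀.2.2.1‖ ^ 2 + ‖y.2.2.2 - q₀.2.2.2‖ ^ 2)) := by
      rw [Real.log_mul hp₀pos.ne' (gauss4_pos hh _ _).ne']
      exact (abs_add_le _ _).trans (add_le_add le_rfl (abs_log_gauss4_le hh q₀ y))
    rw [hL₁]
    linarith

end DVTransfer

/-! ## Registered anchor of this support file -/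

/-- ANCHOR (registered helper stub `bhDVTransfer_moments_anchor` of the crux item): side condition (i1) of the DV
step — for a nonnegative kernel family, `h ≠ 0` and a good initial datum, `contactDens · log contactDens` is
integrable on `Quad` for every window and location. -/
theorem bhDVTransfer_moments_anchor : ∀ (σ : ℝ) (N : ℕ) (ψ : ℕ → T3 → ℝ), (∀ N y, 0 ≤ ψ N y) → ∀ (h : ℝ), h ≠ 0 → ∀ (Φ : Flow σ N) (γc t : ℝ) (z : Cfg N), z ∈ Φ.good → ∀ (k : ℕ) (x : T3), MeasureTheory.Integrable (fun y : Quad => contactDens σ N Φ ψ γc h t z k x y * Real.log (contactDens σ N Φ ψ γc h t z k x y)) :=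
  fun _ _ _ hψ _ hh Φ γc t _ hz k x => DVTransfer.integrable_contactDens_mul_log hψ hh Φ γc t hz k x

end

end Summit.AtomisticToContinuum.HydrodynamicLimit.Theorems.BlockHDissipation
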